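import Summits.ResolutionOfSingularities.ResolutionOfSingularities.Theses.FrobeniusLadder
import Summits.ResolutionOfSingularities.ResolutionOfSingularities.Theorems.FrobeniusLadderFRationalResolutionGradeZeroWeaklyFRegular
import Summits.ResolutionOfSingularities.ResolutionOfSingularities.Theorems.FrobeniusLadderFRationalResolutionDiagQuotientNormal
import Mathlib.RingTheory.LocalProperties.Basic
import HarnessLib

/-!
# Crux `FrobeniusLadder.FRationalResolution` (stmt-ResolutionOfSingularities-15317), line `redirect` —
# `stub_diagonalizableQuotientResolution` with its hypothesis VERBATIM (regular, possibly DISCONNECTED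
# charts) is implied by the crux in characteristic `p` (L6 of leafhand-2 g0's repair census, second half)

`…GradeZeroWeaklyFRegular.lean` (p811956) and `…DiagQuotientOfCrux.lean` (p812245) prove that an integral
`X/k`, `char k = p`, presented by étale charts `Spec S₀ → X` with `S` a regular DOMAIN of finite type
graded by a finite abelian group, has weakly F-regular stalks and is therefore resolved by the crux
`FRationalResolution` by name. The registered stub only asks `IsRegularRing S` — a regular ring is a
finite product of regular domains and the grading group may permute the factors, so `S` is in general
NOT a domain. `…DiagQuotientNormal.isDomain_localization_atPrime_gradeZero` (p812422) did the first
half of removing the hypothesis (the local rings `(S₀)_𝔮` are domains). This file does the second half: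

* `clause_of_retract_of_isRegularRing` — **a DOMAIN `R` that is a split subring of a REGULAR ring `T`
  of prime characteristic `p` (an injective `Λ : R →+* T` with an additive `R`-linear retraction `ρ`)
  has every ideal tightly closed**, with NO domain hypothesis on `T`. Proof: for `c ≠ 0` let
  `J = Ann_T(Λ c)`; `ρ` kills `J` (`c · ρ t = ρ(Λ c · t) = 0` in the domain `R`); at a maximal ideal
  `𝔐 ⊇ I T + J` of `T` the image of `Λ c` in the regular local ring `T_𝔐` is non-zero, so Hochster–Huneke
  (`isTightlyClosed_of_isRegularLocalRing`) gives `Λ y ∈ I T_𝔐`; at a maximal ideal not containing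
  `I T + J` membership is free; hence `Λ y ∈ I T + J` (`Ideal.mem_of_localization_maximal`) and
  `y = ρ (Λ y) ∈ I`.
* `localization_gradeZero_clause_of_isRegularRing`, `stalk_Spec_gradeZero_clause_of_isRegularRing` —
  `(S₀)_𝔮` and the stalks of `Spec S₀` are domains with every ideal tightly closed, for `S` REGULAR of
  finite type over a field of characteristic `p` graded by a torsion group (no `IsDomain S`).
* `weaklyFRegular_stalk_of_regularCharts` — the hypothesis `hW` of `stub_quotientModel` for every
  integral `X/k`, `char k = p`, satisfying the hypothesis `hq` of `stub_diagonalizableQuotientResolution`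
  VERBATIM.
* `fRationalClause_stalk_of_regularCharts`, `stub_diagonalizableQuotientResolution_of_crux` — the
  crux's inline F-rational stalk clause for such `X`, and **`FRationalResolution →` the stub with its
  binders verbatim plus `CharP k p`** (the stub's characteristic-`0` instances are ≤ `Hironaka1964`,
  leafhand-1 p807646).

Honest label: kill-criterion bookkeeping for the line (in characteristic `p` the registered stub is
≤ the crux it serves, for ALL its charts); no stub is closed. No definitions, no named facts, no sorry.
[folklore; cite: HochsterHuneke1990, Thm. 4.4, Prop. 4.12] [cite: BrunsHerzog1998, Thm. 10.1.7 (b)]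
-/

noncomputable section

-- single-problem summit: the doubled namespace component is forced
set_option linter.dupNamespace false

open CategoryTheory DirectSum AlgebraicGeometry
open Literature.AlgebraicGeometry.Resolution
open Literature.AlgebraicGeometry.Resolution.DiagonalizableQuotient
open Literature.RingTheory.TightClosure

namespace Summit.ResolutionOfSingularities.ResolutionOfSingularities.Theorems.FRationalResolution.GradeZeroRegularCharts

/-! ## Split domain subrings of regular rings are weakly F-regular -/

/-- **A domain that is a split subring of a regular ring of characteristic `p` has every ideal
tightly closed** (Hochster–Huneke 1990, Thm. 4.4 + Prop. 4.12, for a regular ring that need NOT be a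
domain). Data: an injective ring map `Λ : R →+* T` into a regular ring `T` (Mathlib `IsRegularRing`:
Noetherian, all local rings at primes regular) of prime characteristic `p`, an additive retraction
`ρ : T →+ R` with `ρ (Λ t) = t` and `ρ (Λ t * g) = t * ρ g`, and `R` a domain. Conclusion: the inline
clause `c ≠ 0 → (∀ e, c * y ^ p ^ e ∈ span {z ^ p ^ e | z ∈ I}) → y ∈ I` for every ideal `I` of `R`.
[cite: HochsterHuneke1990, Thm. 4.4, Prop. 4.12] -/
theorem clause_of_retract_of_isRegularRing (p : ℕ) [Fact p.Prime] {R T : Type} [CommRing R]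
    [IsDomain R] [CommRing T] [CharP T p] [IsRegularRing T] (Λ : R →+* T) (ρ : T →+ R)
    (h1 : ∀ t, ρ (Λ t) = t) (h2 : ∀ t g, ρ (Λ t * g) = t * ρ g) :
    ∀ I : Ideal R, ∀ y c : R, c ≠ 0 →
      (∀ e : ℕ, c * y ^ p ^ e ∈ Ideal.span ((fun z : R => z ^ p ^ e) '' (I : Set R))) →
      y ∈ I := by
  intro I y c hc h
  have hΛ : Function.Injective Λ := fun a b hab => by rw [← h1 a, ← h1 b, hab]
  haveI : CharP R p := Λ.charP hΛ p
  -- the annihilator of `Λ c`, killed by `ρ`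
  let J : Ideal T := (Submodule.span T {Λ c}).annihilator
  have hJ : ∀ t : T, t ∈ J ↔ t * Λ c = 0 := fun t => by
    rw [Submodule.mem_annihilator_span_singleton, smul_eq_mul]
  have hρJ : ∀ t ∈ J, ρ t = 0 := by
    intro t ht
    have h0 : c * ρ t = 0 := by rw [← h2, mul_comm, (hJ t).1 ht, map_zero]
    exact (mul_eq_zero.mp h0).resolve_left hc
  -- `Λ y ∈ I T + J`, checked at every maximal ideal of `T`
  have key : Λ y ∈ I.map Λ ⊔ J := by
    refine Ideal.mem_of_localization_maximal fun 𝔐 h𝔐 => ?_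
    by_cases hle : I.map Λ ⊔ J ≤ 𝔐
    · have hJle : J ≤ 𝔐 := le_sup_right.trans hle
      haveI : IsRegularLocalRing (Localization.AtPrime 𝔐) :=
        IsRegularRing.isRegularLocalRing_localization 𝔐
      haveI : IsDomain (Localization.AtPrime 𝔐) := isDomain_of_isRegularLocalRing _
      haveI : CharP (Localization.AtPrime 𝔐) p :=
        CharP.of_ringHom_of_ne_zero ((algebraMap T (Localization.AtPrime 𝔐)).comp Λ) p
          (Fact.out : p.Prime).ne_zero
      -- `Λ c` does not die in `T_𝔐`: a killer `u ∉ 𝔐` would lie in `J ⊆ 𝔐`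
      have hc' : algebraMap T (Localization.AtPrime 𝔐) (Λ c) ≠ 0 := by
        intro h0
        obtain ⟨⟨u, hu⟩, hu0⟩ := (IsLocalization.map_eq_zero_iff 𝔐.primeCompl _ _).mp h0
        exact hu (hJle ((hJ u).2 hu0))
      have hy' : algebraMap T (Localization.AtPrime 𝔐) (Λ y) ∈
          (I.map Λ).map (algebraMap T (Localization.AtPrime 𝔐)) := by
        rw [Ideal.map_map]
        refine (isTightlyClosed_iff_of_isDomain p).mp (isTightlyClosed_of_isRegularLocalRing p _)
          _ (algebraMap T (Localization.AtPrime 𝔐) (Λ c)) hc' fun e => ?_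
        have hmem := weaklyFRegularClause_of_isRegularRing_map_mem_span_pow_image
          ((algebraMap T (Localization.AtPrime 𝔐)).comp Λ) (h e)
        rwa [map_mul, map_pow, RingHom.comp_apply, RingHom.comp_apply] at hmem
      exact Ideal.map_mono le_sup_left hy'
    · rw [IsLocalization.AtPrime.map_eq_top_of_not_le (Localization.AtPrime 𝔐) hle]
      exact Submodule.mem_top
  obtain ⟨a, ha, j, hj, hsum⟩ := Submodule.mem_sup.mp key
  -- apply the retraction
  letI : Algebra R T := Λ.toAlgebra
  have hmap : algebraMap R T = Λ := rfl
  let ρₗ : T →ₗ[R] R :=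
    { toFun := ρ
      map_add' := ρ.map_add
      map_smul' := fun t g => by
        rw [Algebra.smul_def, hmap, h2, RingHom.id_apply, smul_eq_mul] }
  have ha' : ρ a ∈ I := by
    have := weaklyFRegularClause_of_retract_rho_mem ρₗ I (hmap ▸ ha) 1
    rwa [one_mul] at this
  rw [← h1 y, ← hsum, map_add, hρJ j hj, add_zero]
  exact ha'

/-! ## The local rings of the quotient chart `Spec S₀`, for `S` regular (possibly disconnected) -/

section Graded

variable {k : Type} [Field k] {A : Type} [DecidableEq A] [AddCommGroup A] {S : Type} [CommRing S]
  [Algebra k S] (𝒮 : A → Submodule k S) [GradedAlgebra 𝒮]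

/-- **Every localization `(S₀)_𝔮` at a prime is a domain with every ideal tightly closed**, for `S`
a REGULAR algebra of finite type over a field of characteristic `p` — possibly disconnected — graded by
a torsion group: `(S₀)_𝔮` is a domain (`…DiagQuotientNormal.isDomain_localization_atPrime_gradeZero`),
the Reynolds retraction localizes (`stub_retract_localization`) to a split embedding
`(S₀)_𝔮 → T⁻¹S`, `T = S₀ ∖ 𝔮`, into the regular ring `T⁻¹S` (`stub_isRegularRing_localization`),
and `clause_of_retract_of_isRegularRing` applies. [cite: HochsterHuneke1990, Thm. 4.4, Prop. 4.12] -/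
theorem localization_gradeZero_clause_of_isRegularRing (p : ℕ) [Fact p.Prime] [CharP k p]
    [IsRegularRing S] [Algebra.FiniteType k S] (hA : AddMonoid.IsTorsion A)
    (𝔮 : Ideal (𝒮 0)) [𝔮.IsPrime] :
    IsDomain (Localization.AtPrime 𝔮) ∧ ∀ I : Ideal (Localization.AtPrime 𝔮),
      ∀ y c : Localization.AtPrime 𝔮, c ≠ 0 →
      (∀ e : ℕ, c * y ^ p ^ e ∈ Ideal.span ((fun z : Localization.AtPrime 𝔮 => z ^ p ^ e) ''
        (I : Set (Localization.AtPrime 𝔮)))) → y ∈ I := by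
  haveI hdom : IsDomain (Localization.AtPrime 𝔮) :=
    DiagQuotientNormal.isDomain_localization_atPrime_gradeZero 𝒮 hA 𝔮
  refine ⟨hdom, ?_⟩
  obtain ⟨ρ, h1, h2⟩ := GradeZeroWeaklyFRegular.exists_retract_gradeZero 𝒮
  set Λ : 𝒮 0 →+* S := algebraMap (𝒮 0) S with hΛdef
  have hΛ : Function.Injective Λ := algebraMap_gradeZero_injective 𝒮
  obtain ⟨Λ', ρ', hΛ', h1', h2', -⟩ := stub_retract_localization Λ ρ hΛ h1 h2 𝔮
  -- the big ring `T⁻¹S`: regular of characteristic `p` (NOT a domain in general)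
  haveI : IsRegularRing (Localization (𝔮.primeCompl.map Λ)) := stub_isRegularRing_localization _
  haveI : Nontrivial (Localization (𝔮.primeCompl.map Λ)) := hΛ'.nontrivial
  haveI : Nontrivial (𝒮 0) := nontrivial_of_ne (1 : 𝒮 0) 0 fun h10 =>
    (inferInstance : 𝔮.IsPrime).ne_top ((Ideal.eq_top_iff_one 𝔮).mpr (by rw [h10]; exact 𝔮.zero_mem))
  haveI : Nontrivial S := hΛ.nontrivial
  haveI : CharP S p := charP_of_injective_algebraMap (algebraMap k S).injective p
  haveI : CharP (Localization (𝔮.primeCompl.map Λ)) p :=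
    charP_of_injective_algebraMap (algebraMap k (Localization (𝔮.primeCompl.map Λ))).injective p
  exact clause_of_retract_of_isRegularRing p Λ' ρ' h1' h2'

/-- **The stalks of the quotient chart `Spec S₀` are domains with every ideal tightly closed**
(`S` regular of finite type over a field of characteristic `p`, torsion grading; no domain
hypothesis). [cite: HochsterHuneke1990, Thm. 4.4, Prop. 4.12] -/
theorem stalk_Spec_gradeZero_clause_of_isRegularRing (p : ℕ) [Fact p.Prime] [CharP k p]
    [IsRegularRing S] [Algebra.FiniteType k S] (hA : AddMonoid.IsTorsion A)
    (v : Spec (.of (𝒮 0))) :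
    IsDomain ((Spec (.of (𝒮 0))).presheaf.stalk v) ∧
      ∀ I : Ideal ((Spec (.of (𝒮 0))).presheaf.stalk v),
      ∀ u c : (Spec (.of (𝒮 0))).presheaf.stalk v, c ≠ 0 →
      (∀ e : ℕ, c * u ^ p ^ e ∈ Ideal.span ((fun z : (Spec (.of (𝒮 0))).presheaf.stalk v =>
        z ^ p ^ e) '' (I : Set ((Spec (.of (𝒮 0))).presheaf.stalk v)))) → u ∈ I := by
  letI : Algebra (𝒮 0) ((Spec (.of (𝒮 0))).presheaf.stalk v) :=
    inferInstanceAs (Algebra (𝒮 0) ((Spec.structureSheaf (𝒮 0)).presheaf.stalk v))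
  haveI : IsLocalization.AtPrime ((Spec (.of (𝒮 0))).presheaf.stalk v) v.asIdeal :=
    StructureSheaf.IsLocalization.to_stalk (𝒮 0) v
  let e : (Spec (.of (𝒮 0))).presheaf.stalk v ≃+* Localization.AtPrime v.asIdeal :=
    (IsLocalization.algEquiv v.asIdeal.primeCompl ((Spec (.of (𝒮 0))).presheaf.stalk v)
      (Localization.AtPrime v.asIdeal)).toRingEquiv
  exact GradeZeroWeaklyFRegular.clause_of_ringEquiv p (T := Localization.AtPrime v.asIdeal) e
    (localization_gradeZero_clause_of_isRegularRing 𝒮 p hA v.asIdeal)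

end Graded

/-! ## Stalks of `X` under the stub's hypothesis verbatim -/

/-- **Diagonalizable quotient singularities with REGULAR charts are weakly F-regular.** Let `k` be a
field of characteristic `p` and `X` an integral `k`-scheme every point of which lies in the image of
an étale `k`-morphism `Spec S₀ → X`, where `S` is a REGULAR (possibly disconnected) algebra of finite
type over `k` graded by a finite abelian group `A` and `S₀` is its degree-`0` part — the hypothesis
`hq` of `stub_diagonalizableQuotientResolution` VERBATIM. Then every local ring of `X` is a domain in
which every ideal is tightly closed (the hypothesis `hW` of `stub_quotientModel` / rung 4′, verbatim).
[cite: HochsterHuneke1990, Thm. 4.4, Prop. 4.12] -/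
theorem weaklyFRegular_stalk_of_regularCharts (p : ℕ) [Fact p.Prime] (k : Type) [Field k]
    [CharP k p] (X : Scheme.{0}) (g : X ⟶ Spec (.of k)) [IsIntegral X]
    (hq : ∀ x : X, ∃ (A : Type) (_ : AddCommGroup A) (_ : Finite A) (_ : DecidableEq A)
        (S : Type) (_ : CommRing S) (_ : Algebra k S) (𝒮 : A → Submodule k S)
        (_ : GradedAlgebra 𝒮), Algebra.FiniteType k S ∧ IsRegularRing S ∧
        ∃ φ : Spec (.of (𝒮 0)) ⟶ X, Etale φ ∧ x ∈ Set.range φ ∧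
          φ ≫ g = Spec.map (CommRingCat.ofHom (algebraMap k (𝒮 0))))
    (x : X) :
    IsDomain (X.presheaf.stalk x) ∧ ∀ I : Ideal (X.presheaf.stalk x),
      ∀ y c : X.presheaf.stalk x, c ≠ 0 →
      (∀ e : ℕ, c * y ^ p ^ e ∈ Ideal.span ((fun z : X.presheaf.stalk x => z ^ p ^ e) ''
        (I : Set (X.presheaf.stalk x)))) → y ∈ I := by
  obtain ⟨A, _, _, _, S, _, _, 𝒮, _, _, _, φ, _, ⟨v, rfl⟩, -⟩ := hq x
  have hA : AddMonoid.IsTorsion A := fun a => isOfFinAddOrder_of_finite a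
  exact GradeZeroWeaklyFRegular.clause_stalk_of_flat p φ v
    (stalk_Spec_gradeZero_clause_of_isRegularRing 𝒮 p hA v)

/-- **The crux's F-rational stalk clause for diagonalizable quotient singularities with regular
charts** (characteristic `p`; hypothesis `hq` of the stub verbatim): every stalk is a domain whose
parameter ideals are tightly closed — indeed all ideals are. [cite: HochsterHuneke1990, Prop. 4.12] -/
theorem fRationalClause_stalk_of_regularCharts (p : ℕ) [Fact p.Prime] (k : Type) [Field k]
    [CharP k p] (X : Scheme.{0}) (g : X ⟶ Spec (.of k)) [IsIntegral X]
    (hq : ∀ x : X, ∃ (A : Type) (_ : AddCommGroup A) (_ : Finite A) (_ : DecidableEq A)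
        (S : Type) (_ : CommRing S) (_ : Algebra k S) (𝒮 : A → Submodule k S)
        (_ : GradedAlgebra 𝒮), Algebra.FiniteType k S ∧ IsRegularRing S ∧
        ∃ φ : Spec (.of (𝒮 0)) ⟶ X, Etale φ ∧ x ∈ Set.range φ ∧
          φ ≫ g = Spec.map (CommRingCat.ofHom (algebraMap k (𝒮 0))))
    (x : X) :
    IsDomain (X.presheaf.stalk x) ∧ ∀ d : ℕ, ringKrullDim (X.presheaf.stalk x) = d →
      ∀ s : Fin d → X.presheaf.stalk x, (Ideal.span (Set.range s)).radical.IsMaximal →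
      ∀ y c : X.presheaf.stalk x, c ≠ 0 →
      (∀ e : ℕ, c * y ^ p ^ e ∈ Ideal.span ((fun z : X.presheaf.stalk x => z ^ p ^ e) ''
        (Ideal.span (Set.range s) : Set (X.presheaf.stalk x)))) → y ∈ Ideal.span (Set.range s) := by
  obtain ⟨hdom, hcl⟩ := weaklyFRegular_stalk_of_regularCharts p k X g hq x
  exact ⟨hdom, fun _ _ s _ y c hc hmem => hcl _ y c hc hmem⟩

/-- **`stub_diagonalizableQuotientResolution` — in characteristic `p`, with its hypothesis `hq`
VERBATIM (regular, possibly disconnected charts) — is implied by the crux `FRationalResolution` BY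
NAME**: such an `X` is its own F-rational model (the identity is proper and birational and its stalks
satisfy the crux's clause by `fRationalClause_stalk_of_regularCharts`), so the crux resolves it. The
stub's binders are carried verbatim (`IsSeparated`, `LocallyOfFiniteType`, `QuasiCompact`,
`IsIntegral`) plus `CharP k p` (its characteristic-`0` instances are outside the crux's scope).
[folklore] -/
theorem stub_diagonalizableQuotientResolution_of_crux
    (hcrux : Summit.ResolutionOfSingularities.ResolutionOfSingularities.Theses.FrobeniusLadder.FRationalResolution)
    (p : ℕ) (hp : p.Prime) (k : Type) [Field k] [CharP k p] (X : Scheme.{0})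
    (g : X ⟶ Spec (.of k)) [IsIntegral X] [IsSeparated g] [LocallyOfFiniteType g] [QuasiCompact g]
    (hq : ∀ x : X, ∃ (A : Type) (_ : AddCommGroup A) (_ : Finite A) (_ : DecidableEq A)
        (S : Type) (_ : CommRing S) (_ : Algebra k S) (𝒮 : A → Submodule k S)
        (_ : GradedAlgebra 𝒮), Algebra.FiniteType k S ∧ IsRegularRing S ∧
        ∃ φ : Spec (.of (𝒮 0)) ⟶ X, Etale φ ∧ x ∈ Set.range φ ∧
          φ ≫ g = Spec.map (CommRingCat.ofHom (algebraMap k (𝒮 0)))) :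
    Scheme.HasResolution X := by
  haveI : Fact p.Prime := ⟨hp⟩
  have hbir : IsBirational (𝟙 X) := ⟨⊤, by simp [dense_univ], by simp [dense_univ], inferInstance⟩
  exact hcrux p hp k X g inferInstance inferInstance inferInstance inferInstance
    ⟨X, 𝟙 X, inferInstance, hbir, fRationalClause_stalk_of_regularCharts p k X g hq⟩

end Summit.ResolutionOfSingularities.ResolutionOfSingularities.Theorems.FRationalResolution.GradeZeroRegularCharts

end
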